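import Mathlib

/-!
# StrengthenEulerBudget — kernel-checked pieces of STRENGTHEN MEMO-05 (plan-lens-HodgeAV-strengthen g2)

MEMO-05 (`Cruxes/BlochSeedDiscOne/STRENGTHEN-MEMO-05-EULER-BUDGET.md`) answers director question
R19.240 (4) («does any typed seed hypothesis turn `ext²(𝓔,𝓔) ≤ 3136` and `χ(𝓔,𝓔) = 2|μ|²` into an
upper bound on `|μ|`?») with NO, via the floor `ext⁴(𝓔,𝓔) ≥ 2|μ|² − 2·nd(C,A)` on every LINE letter
presentation. The algebraic geometry (Mumford index theorem, generic-twist vanishing, upper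
semicontinuity, Koszul) is pencil mathematics recorded in the memo; this file checks the finite
LETTER CALCULUS and the integer BOOKKEEPING the memo's corollaries rest on:

* `lineDiff_Q_eq`, `lineDiff_Q_nonpos`, `lineDiff_Q_eq_zero_iff` — LEMMA 1 (index lemma): the
  per-factor Euler form `Q = Δα² − Δx² − Δy²` of the difference of two LINE-`n` letters
  `(n − c, x, y)`, `(n − c', x', y')` (`x² + y² = c²`, `x'² + y'² = c'²`) equals `2(xx' + yy' − cc')`,
  is `≤ 0` (never timelike), and vanishes iff `xx' + yy' = cc'` (phases positively parallel);
* `oneRow_floor` — the Euler step of THEOREM C (ii);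
* `corollary_D1`, `corollary_D3`, `corollary_D5` — THEOREM B − ½·THEOREM C;
* `envelope_step` — the rank–nullity inequality behind the envelopes (3.3).

Evidence, not a rung: nothing here is proved toward HC ∕ HC_CM ∕ HC_AV ∕ №4 ∕ 26512 ∕ 18881 ∕ H2.
-/

set_option linter.dupNamespace false

namespace Summit.HodgeConjecture.HodgeConjecture.Cruxes.BlochSeedDiscOne.StrengthenEulerBudget

/-- Per-factor Euler form of a letter difference `(Δα, Δx, Δy)` on `S = E_i × E_i`
(`= χ_S` of the difference line bundle; the `kFactor`/`det` form of `C4StabilitySpec`). -/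
def Q (a x y : ℤ) : ℤ := a ^ 2 - x ^ 2 - y ^ 2

/-- LEMMA 1, exact form: for LINE-`n` letters the difference form is `2(xx' + yy' − cc')`. -/
theorem lineDiff_Q_eq (n c c' x y x' y' : ℤ)
    (h : x ^ 2 + y ^ 2 = c ^ 2) (h' : x' ^ 2 + y' ^ 2 = c' ^ 2) :
    Q ((n - c') - (n - c)) (x' - x) (y' - y) = 2 * (x * x' + y * y' - c * c') := by
  unfold Q
  linear_combination (-1 : ℤ) * h + (-1 : ℤ) * h'

/-- Cauchy–Schwarz in `ℤ[i]` (Lagrange's identity): `xx' + yy' ≤ cc'` when `|β| = c`, `|β'| = c'`. -/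
theorem re_mul_conj_le (c c' x y x' y' : ℤ) (hc : 0 ≤ c) (hc' : 0 ≤ c')
    (h : x ^ 2 + y ^ 2 = c ^ 2) (h' : x' ^ 2 + y' ^ 2 = c' ^ 2) :
    x * x' + y * y' ≤ c * c' := by
  have lag : (x * x' + y * y') ^ 2 + (x * y' - y * x') ^ 2 = (c * c') ^ 2 := by
    have e : (x * x' + y * y') ^ 2 + (x * y' - y * x') ^ 2 = (x ^ 2 + y ^ 2) * (x' ^ 2 + y' ^ 2) := by
      ring
    rw [e, h, h']; ring
  have hsq : (x * x' + y * y') ^ 2 ≤ (c * c') ^ 2 := by nlinarith [sq_nonneg (x * y' - y * x')]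
  have hcc : 0 ≤ c * c' := mul_nonneg hc hc'
  rcases le_or_gt (x * x' + y * y') (c * c') with hle | hlt
  · exact hle
  · exfalso
    have hpos : 0 < x * x' + y * y' + c * c' := by linarith
    nlinarith [mul_pos (sub_pos.mpr hlt) hpos]

/-- LEMMA 1 (index lemma): the difference of two LINE-`n` letters is never timelike (`Q ≤ 0` on
every factor), hence a LINE letter pair is spacelike (Mumford index 1) or null on each factor and a
non-degenerate LINE pair has total index 4 (MEMO-05 §3). -/
theorem lineDiff_Q_nonpos (n c c' x y x' y' : ℤ) (hc : 0 ≤ c) (hc' : 0 ≤ c')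
    (h : x ^ 2 + y ^ 2 = c ^ 2) (h' : x' ^ 2 + y' ^ 2 = c' ^ 2) :
    Q ((n - c') - (n - c)) (x' - x) (y' - y) ≤ 0 := by
  rw [lineDiff_Q_eq n c c' x y x' y' h h']
  have := re_mul_conj_le c c' x y x' y' hc hc' h h'
  linarith

/-- The null case of LEMMA 1: `Q = 0` iff `xx' + yy' = cc'` (the two phases positively parallel,
or one letter of modulus `0`) — exactly the DEGENERATE factor pairs of MEMO-05 §3. -/
theorem lineDiff_Q_eq_zero_iff (n c c' x y x' y' : ℤ)
    (h : x ^ 2 + y ^ 2 = c ^ 2) (h' : x' ^ 2 + y' ^ 2 = c' ^ 2) :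
    Q ((n - c') - (n - c)) (x' - x) (y' - y) = 0 ↔ x * x' + y * y' = c * c' := by
  rw [lineDiff_Q_eq n c c' x y x' y' h h']
  omega

/-- A BAND pair is timelike at once (MEMO-05 §7, M72 example): letters `(5,−3,0)` (top 8) and
`(10,−2,0)` (top 12) differ by `(5,1,0)` with `Q = 24 > 0`; the one-top hypothesis of LEMMA 1 is
necessary. -/
example : Q (10 - 5) (-2 - (-3)) (0 - 0) = 24 := by decide

/-- THEOREM C (ii), the Euler step on the generic one-row complex: if the generic-twist
cohomology `h2 … h6` of `End 𝓔` has Euler characteristic `chi` (`= 2|μ|²` on LINE), vanishes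
outside degrees `2…6`, and `h2 ≤ nd₋₂`, `h6 ≤ nd₂` (the non-degenerate `(C,A)`-masses), then
`h4 ≥ chi − nd₋₂ − nd₂`. -/
theorem oneRow_floor (chi h2 h3 h4 h5 h6 ndm2 nd2 : ℤ)
    (hchi : chi = h2 - h3 + h4 - h5 + h6) (h3nn : 0 ≤ h3) (h5nn : 0 ≤ h5)
    (hh2 : h2 ≤ ndm2) (hh6 : h6 ≤ nd2) :
    chi - ndm2 - nd2 ≤ h4 := by omega

/-- COROLLARY D1 (THEOREM B − ½·THEOREM C): from the Euler identity with Serre symmetry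
`2M = 2h⁰ − 2e¹ + 2e² − 2e³ + e⁴` (`M = |μ|²`) and the floor `e⁴ ≥ 2M − 2ν` (`ν = nd(C,A)`):
`h⁰ + e² ≤ e¹ + e³ + ν` — the modulus `M` has dropped out. -/
theorem corollary_D1 (M h0 e1 e2 e3 e4 ν : ℤ)
    (hB : 2 * M = 2 * h0 - 2 * e1 + 2 * e2 - 2 * e3 + e4) (hC : 2 * M - 2 * ν ≤ e4) :
    h0 + e2 ≤ e1 + e3 + ν := by omega

/-- COROLLARY D3 (traceless odd vanishing is a KILL, not a budget): with `ν = 0`, the traceless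
Euler identity `2M = 2a⁰ − 2a¹ + 2a² − 2a³ + a⁴`, the traceless floor `a⁴ ≥ 2M`, and `a¹ = a³ = 0`,
one gets `a⁰ = 0` (simple), `a² = 0` (`Ext² = H²(𝒪)·id`) and `a⁴ = 2M`; MEMO-05 then invokes
Mukai 1978 Thm 5.8 ((1) ⟺ (2)) and the cell's THEOREM SH to conclude `μ = 0`. -/
theorem corollary_D3 (M a0 a1 a2 a3 a4 : ℤ)
    (hB : 2 * M = 2 * a0 - 2 * a1 + 2 * a2 - 2 * a3 + a4) (hC : 2 * M ≤ a4)
    (h1 : a1 = 0) (h3 : a3 = 0) (h0nn : 0 ≤ a0) (h2nn : 0 ≤ a2) :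
    a0 = 0 ∧ a2 = 0 ∧ a4 = 2 * M := by omega

/-- COROLLARY D5 (the only converting hypothesis is a bound on `e⁴`, and it IS a bound on `M`):
an upper bound `e⁴ ≤ B` gives `2M ≤ 2h⁰ + 2e² + B` from the identity alone, and conversely the
floor turns `e⁴ ≤ B` into `2M ≤ B + 2ν` directly. -/
theorem corollary_D5 (M h0 e1 e2 e3 e4 ν B : ℤ)
    (hB : 2 * M = 2 * h0 - 2 * e1 + 2 * e2 - 2 * e3 + e4) (hC : 2 * M - 2 * ν ≤ e4)
    (he1 : 0 ≤ e1) (he3 : 0 ≤ e3) (hbound : e4 ≤ B) :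
    2 * M ≤ 2 * h0 + 2 * e2 + B ∧ 2 * M ≤ B + 2 * ν := by
  constructor <;> omega

/-- The rank–nullity step behind the envelopes (3.3): for linear maps `f : V₀ → V₁`, `g : V₁ → V₂`
of finite-dimensional spaces, `dim V₁ − dim V₀ − dim V₂ ≤ dim ker g − dim range f`
(`≤ dim` of the homology at `V₁` when `g ∘ f = 0`). Iterated through the pages of the letter
spectral sequence it gives `E₁^k − E₁^{k−1} − E₁^{k+1} ≤ ext^k ≤ E₁^k`. -/
theorem envelope_step {K V₀ V₁ V₂ : Type*} [Field K]
    [AddCommGroup V₀] [Module K V₀] [FiniteDimensional K V₀]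
    [AddCommGroup V₁] [Module K V₁] [FiniteDimensional K V₁]
    [AddCommGroup V₂] [Module K V₂] [FiniteDimensional K V₂]
    (f : V₀ →ₗ[K] V₁) (g : V₁ →ₗ[K] V₂) :
    (Module.finrank K V₁ : ℤ) - Module.finrank K V₀ - Module.finrank K V₂
      ≤ (Module.finrank K (LinearMap.ker g) : ℤ) - Module.finrank K (LinearMap.range f) := by
  have h1 : Module.finrank K (LinearMap.range f) ≤ Module.finrank K V₀ :=
    LinearMap.finrank_range_le f
  have h2 : Module.finrank K (LinearMap.range g) + Module.finrank K (LinearMap.ker g)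
      = Module.finrank K V₁ := LinearMap.finrank_range_add_finrank_ker g
  have h3 : Module.finrank K (LinearMap.range g) ≤ Module.finrank K V₂ := Submodule.finrank_le _
  omega

end Summit.HodgeConjecture.HodgeConjecture.Cruxes.BlochSeedDiscOne.StrengthenEulerBudget
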